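import Literature.MathematicalPhysics.QuantumFieldTheory.Balaban1983to89.T4TermwiseBCH

/-!
# T⁴ continuum, node U5 (NE7), TERM-WISE member — the TORUS BOOKKEEPING (tor)+(pos)+(ker) behind the BCH binder:
# Bałaban's concrete average (42) is translation-covariant and descends to the torus; on `(ℤ/Tℤ)^d` with `T = nL`
# the averaging kernel `w(p′, p) = L^{−d}·#{slots of the window of p′ sitting at p}` is `≥ 0`, has ROW SUMS `L²`
# and COLUMN SUMS `L^{2−d}` (`= L⁻²` in d = 4) — generation 10's `hw`/`hrow`/`hcol`/`hNf`/`hNc` PRODUCED — and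
# generation 11's `bch_concrete` reads, re-indexed, as the kernel-form binder `‖ψ(p′) − Σ_x w(p′,x)•Φ(p′,x)‖ ≤ 280θ²`

Lineage t4-ne7-p1 (term-wise matching modulo constants), generation 12.  HONEST FRAMING (page 1): pure YM₄ on a FIXED
FINITE torus T⁴, rung (B)+1 of the cell's ladder = the `ε → 0` limit of expectations of gauge-invariant observables; NOT
infinite volume, NOT a mass gap, NOT the Clay problem.  Spine estimate NE7 (node U5: for every `K` a `t`-independent
constant `c_K` with `|log Z^B_{K+1}(t) − log Z^A_K(t) − c_K| ≤ δ_K·|T₁|`, `Σ_K δ_K < ∞`) is NOT PRINTED for Bałaban's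
d = 4 procedure (d = 2, 3 template [King1986] (3.10)–(3.13) pp. 656–657, TEMPLATE ONLY).  The conditionals of the lineage
— the flow window (0.31) of [Balaban1987RG1] (the cell's BetaPertH road; tree `Step.Discrete031`), (B), (B^μ) — are
untouched by this leaf: they sit BY NAME in the binders `h031A`/`h031B` of generation 10's capstone
`T4TermwiseQuartic.goodClause_summable_of_kindsRA_regular` and inside the producers of its other binders, exactly where
those modules declare them; nothing here discharges or hides them.  This leaf is COMBINATORIAL BOOKKEEPING about the
concrete average (42) (`B7Prop1Explicit.bavg`, cell unit b2b-balaban-b07, reached BY NAME through generation 11's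
`T4TermwiseBCH`; nothing upstream edited): translation covariance, periodicity, the tiling of the torus by blocks and the
resulting incidence counts, and the re-indexing of `bch_concrete` from window slots to a kernel over fine plaquettes.
Bookkeeping DEFINITIONS only (`tcls`, `box`, `tlift`, `IsPeriodic`, `slots`, `zpos`, `tker`, `pbox`, `pker`, `textend`),
no `sorry`, no hypothesis beyond those of B7 Proposition 1: every statement is [folklore] combinatorics on `ℤ^d` /
`(ℤ/Tℤ)^d` or a re-indexing of the tree's theorems `B7Prop1Explicit.*` / `T4TermwiseBCH.bch_concrete`.

CITATION HEADER (lean-in-tree rule 2026-08-18).  Audit cell `pub-balaban`, sub-cell t4 (unit b2b-balaban-t4-ne7-p1-g12).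
Source: T. Bałaban, *Averaging operations for lattice gauge theories*, Commun. Math. Phys. **98**, 17–51 (1985)
[Balaban1985Averaging] (cell paper B7; journal page = PDF page + 16), as quoted VERBATIM in the headers of the tree modules
`B7Prop1Explicit` (v1.0.1; pp. 17–19, 23–26) and `T4TermwiseBCH` ((45)–(51)), renders pp. 18–19 re-read as images for v1.1:
p. 17 «We consider a subdomain Ω of the lattice ηZ^d» with the blocks (2)–(3) p. 17 (`B(y) = {x : y_μ ≤ x_μ < y_μ + L}`,
= B5 [Balaban1984PropagatorsI] (1.6)); p. 18 (4) and «The above definitions of bonds and plaquettes may be applied to an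
arbitrary lattice, e.g., to Ω^{(j)}.»; p. 19 «In fact, Ω^{(j)} may be replaced by any other lattice.»; (9) p. 18 parallel
transport; (14) p. 19 the contours `Γ_{c,x}`; the average (42) p. 23 (= (15) p. 19) «Ū_c = exp[i Σ_{x∈B(c₋)} L^{−d} (1/i)
log U(Γ_{c,x}) U(c)⁻¹] U(c)», transcribed for `V` (no `i·(1/i)`) as `B7Prop1Explicit.bavg`; (47)–(48) p. 25 the window sum
«`Σ_{x∈B(y₀)} L^{−d} Σ_{p⊂(p′)_x} A(∂p)`» (right-hand side of (48)); Proposition 1 (51) p. 26 and p. 25 «Let us notice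
that it is a local result».  THE TORUS is the setting of B12 = T. Bałaban, *Renormalization group approach to lattice gauge
field theories. I*, Commun. Math. Phys. **109**, 249–301 (1987) [Balaban1987RG1] p. 251 (render
`1987-cmp109-rg-I-small-field-p003` read as an image): «Consider a lattice as a subset of a continuous Euclidean space R^d,
or a torus T obtained by the usual identification of boundary points of the cube {x ∈ R^d : −L_μ ≤ x_μ ≤ L_μ, μ = 1, …,
d}» and (0.1) «Define the initial lattice approximation on the torus» (the cell's `Setup`: `[cite: Balaban1987RG1, (0.1) p.251]`);
B7 itself prints no "torus" on pp. 17–26 (it works on «an arbitrary lattice» / «any other lattice», pp. 18–19) — v1's phrase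
"a torus or the whole space" attributed to B7 p. 18 was a paraphrase inherited from `B7Prop1Explicit` v1 and is WITHDRAWN in
v1.1 (cross-read C-pv04g21-3; upstream withdrawn in `B7Prop1Explicit` v1.0.1).  Nothing else of the papers is used.  The torus incidence count (`slot_count`) is elementary and is NOT
a display of the paper: B7 never writes the average as a kernel over fine plaquettes — (47)–(50) are per window — so the
kernel `w` below is THIS CELL's reading of (42)/(47), with every property kernel-checked, not quoted.

## Why this leaf (record `t4/T4-EST-NE7-P1.md` v11 §15 (15c), (15d)(v) — the record's words, not print: after generation 11
## "what separates `bch_concrete` from generation 10's binder AS TYPED is bookkeeping, recorded not done: (tor) … (pos) … (id-V)",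
## and (ker) "is otherwise generation 10's hypothesis on ITS abstract `w`")
Generation 10 (`T4TermwiseQuartic.interpolation_averaging_of_regular`) takes, at every tower level `K`, finsets
`Pf K ⊂ Xf`, `Pc K ⊂ Xc` of fine / coarse plaquettes of FIXED types, a kernel `w K : Xc → Xf → ℝ` with (ker)
`hw : 0 ≤ w`, `hrow : Σ_{x∈Pf} w y x = L²`, `hcol : Σ_{y∈Pc} w y x = (L²)⁻¹`, counts (cnt) `hNf : #Pf K ≤ n₀·vol·(L^{K+1})^4`,
`hNc : #Pc K ≤ n₀·vol·(L^K)^4`, transported fields with (tr) `hΦA : ‖ΦA y x‖ = ‖φA x‖` for ALL `y ∈ Pc`, `x ∈ Pf`, the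
BCH binder (bch) `hρA : ‖ψA y − Σ_{x∈Pf} w y x • ΦA y x‖ ≤ ρb K`, and an oscillation binder (osc) on pairs `x, x′` with
`0 < w y x`, `0 < w y x′`.  Generation 11 proved (bch)+(tr) for the concrete average (42) on `ℤ^d` in WINDOW-indexed form
(a triple sum over the slots `(x′ ∈ B(y₀), p ⊂ (p′)_{x′})`).  THIS LEAF supplies the dictionary between the two index
conventions ON THE TORUS and PRODUCES (ker)+(cnt), with `Xf = Xc = (plane) × ℤ^d` (representatives `[0,N)^d` of
`(ℤ/Nℤ)^d`, so the types do not vary with `K`), fine torus of `T = nL` sites per direction, coarse of `n`: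
* (tor) (42) is translation-COVARIANT on `ℤ^d` (`bavg_shift`: `\overline{V(· + v)} = V̄(· + v)`; likewise `hol`,
  `axialFn`, `cplaq`), hence a `T`-periodic `V` — a configuration on the torus read on the universal cover — has a
  `T`-periodic average whose restriction to the `L`-lattice is `n`-periodic (`IsPeriodic.bavg`, `IsPeriodic.bavg_coarse`):
  the one-step average IS a map (torus of side `nL`) → (torus of side `n`) (B7 p. 19 «In fact, Ω^{(j)} may be replaced by
  any other lattice.»; the torus itself is B12 (0.1) p. 251), with B7's formulas and the
  tree's Proposition 1 unchanged (Prop. 1 «is a local result»);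
* (pos)+(ker) the kernel `w(a, x) = L^{−d}·#{slots of the window of the coarse plaquette a whose position ≡ x mod T}`
  (`tker`) is `≥ 0`, has ROW sums `Σ_{x∈[0,T)^d} w(a,x) = L²` (each of the `L^d·L²` slots sits at exactly one
  representative; `tker_row_sum`) and COLUMN sums `Σ_{a∈[0,n)^d} w(a,x) = L^{−d}·L²` (`tker_col_sum` ⇐ `slot_count`:
  blocks tile the torus, `blocks_tile`, so for each of the `L²` places `(i, j)` in a window exactly one window has its
  `(i, j)`-th plaquette at `x`) — `= (L²)⁻¹` in `d = 4` (`tker_col_sum_four`), generation 10's `hcol` LITERALLY; plane labels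
  enter block-diagonally (`pker`, `pker_sum_eq`), the counts are `#planes·N^d` (`card_pbox`), and `kernel_tower` /
  `kernel_tower_geometric` package the five facts in generation 10's tower-indexed shape (`n_K = M·L^K`:
  `#Pf K = #planes·M^4·(L^{K+1})^4`, i.e. `n₀ = #planes`, `vol = M^4`, with EQUALITY);
* (bch) re-indexed: for `T ≥ 2L` the positions of ONE window are distinct mod `T` (`zpos_eq_of_tcls_eq`), so generation
  11's weighted window sum equals the kernel sum `Σ_{x∈[0,T)^d} w(a,x) • Φ(p′,x)` (`window_sum_eq_kernel_sum`) with
  `Φ(p′, ·)` the torus extension (`textend`) of the transported field; whence `bch_torus`: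
  `‖log V̄(∂p′) − Σ_x w(a,x) • Φ(p′,x)‖ ≤ 280θ²` — the binder `hρA`/`hρB` in generation 10's kernel form — and, for PERIODIC
  `V`, (tr) `‖Φ(p′,x)‖ = ‖log V(∂p_x)‖` at EVERY `x` (`norm_textend_transport`), the binder `hΦA`/`hΦB` as quantified
  there; (osc)'s support is one window (`osc_support`, `zpos_sub_corner_bounds`: `≤ 2L − 2` steps across).

DICTIONARY print ↦ Lean (that of `B7Prop1Explicit` / `T4TermwiseBCH`, plus): torus point ↦ class
`tcls T x : Fin d → ZMod T` of `x : ℤ^d`, representative `tlift ξ ∈ box T = [0,T)^d`; configuration on the torus ↦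
`T`-periodic `V` on `ℤ^d` (`IsPeriodic T V`); coarse plaquette `p′` (corner `y₀ = La`, plane `μ ≠ ν`) ↦ block index
`a ∈ box n` (+ plane label `(μ, ν)`); slot `(x′ ∈ B(y₀), p ⊂ (p′)_{x′})` ↦ `s = (r, i, j) ∈ slots L`, its position
`p₋ ↦ zpos L μ ν (L•a) s = La + r + ie_μ + je_ν` (= generation 11's `x r i j`); kernel `w K y x ↦ tker T L μ ν a x`, plane-
labelled `pker`; `Pf K, Pc K ↦ pbox planes T, pbox planes n`; `ΦA y x ↦ textend T L μ ν (L•a) G φ x` with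
`G x′ = T_{p′,x′} (log V(∂p_{x′})) T_{p′,x′}⁻¹`, `T_{p′,x′} = u(y₀)⁻¹u(x′)`, `u = axialFn V y`, and `φ x = log V(∂p_x)`.

## What this module adds (additive leaf; imports `T4TermwiseBCH` BY NAME; bookkeeping definitions, no `sorry`)
§1 `hol_shift`, `axialFn_shift`, `gaugeAct_shift`, `Wcx_shift`, `Xavg_shift`, `bavg_shift` (**(42) is translation-
   covariant**), `cplaq_shift`, `cplaq_bavg_shift`.
§2 `tcls`, `tcls_add`, `tcls_period`, `tcls_eq_tcls_iff` (same class ⟺ differ by `Tℤ^d`); `box`, `card_box` (`= N^d`),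
   `mem_box`, `boxVec_injective`; `tlift`, `tcls_tlift`, `tlift_mem_box`, `tlift_tcls_of_mem_box`, `tcls_injOn_box`,
   `tcls_eq_tcls_iff_tlift_eq` (`[0,T)^d ≃ (ℤ/Tℤ)^d`).
§3 `IsPeriodic`; `.eq_of_tcls_eq`, `.apply_tlift`, `.descends` (a periodic field is the pull-back of a unique field on
   the torus); `.hol`, `.axialFn`, `.gaugeAct`, `.bavg` (**the average of a periodic configuration is periodic**),
   `.cplaq`, `.bavg_coarse` (`a ↦ V̄(La)` is `n`-periodic for `T = nL`).
§4 `slots`, `card_slots` (`L^d·L²`), `zpos`, `zpos_mk`, `tcls_zpos`, `zpos_sub_corner_bounds`, `zpos_eq_of_tcls_eq`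
   (positions of one window are distinct mod `T ≥ 2L`); `blocks_tile` (mixed radix: `[0,n)^d × [0,L)^d ≃ (ℤ/nLℤ)^d`);
   **`slot_count`** (every torus point is the position of exactly `L²` slots, counted over all blocks).
§5 `tker`, `tker_nonneg` (hw), `exists_slot_of_tker_ne_zero`, **`tker_row_sum`** (`= L²`, hrow), **`tker_col_sum`**
   (`= L^{−d}L²`), `tker_col_sum_four` (`= (L²)⁻¹`, hcol); §5b `pbox`, `card_pbox` (hNf/hNc), `pker`, `pker_nonneg`,
   `pker_row_sum`, `pker_col_sum`, `pker_sum_eq`, `pker_col_sum_four`, **`kernel_tower`**, `kernel_tower_geometric`.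
§6 `textend`, `textend_of_tker_ne_zero`, `norm_textend`, **`window_sum_eq_kernel_sum`**, **`bch_torus`**,
   `norm_textend_transport`, `osc_support`.
§7 three toys (non-vacuity of `slot_count`, `kernel_tower`, `bch_torus`).  No physics beyond B7 pp. 17–26 (+ the torus
setting of B12 (0.1) p. 251).

## Binder status for generation 10's `interpolation_averaging_of_regular` (cumulative with generation 11)
(ker) `hw hrow hcol` and (cnt) `hNf hNc`: PRODUCED (`kernel_tower`; d = 4, any `n_K ≥ 1`, `L ≥ 1`; EQUALITY in the counts).
(tr) `hΦA hΦB`: PRODUCED at every `x ∈ Pf` for periodic configurations (`norm_textend_transport` + `pker_sum_eq`).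
(bch) `hρA hρB`: PRODUCED in kernel form on the torus of representatives (`bch_torus`, `ρb = 280θ²`; hypotheses those of
  Prop. 1 for the periodic lift, `T ≥ 2L`), in the norm of `𝔸`; the identification (id-V) with generation 10's real
  inner-product space `V` is still generation 11's `norm_sub_window_sum_of_isometry` (the isometry is NOT constructed;
  SU(2) up to a factor, SU(N ≥ 3) with constants) — UNCHANGED.
(osc): support localised to one window (`osc_support`); the RATE (osc-U) is NOT PRINTED as an inequality (locus
  [Balaban1985Variational] pp. 280–286 per the cell's literature record) — UNCHANGED, a hypothesis upstream.
UNCHANGED, still hypotheses upstream: (osc-U), (W-w), the size law `hs` of (sz)/(scal), (repr), (wt) beyond U(1)/SU(2),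
(0.31) = `h031A`/`h031B`, (B), (B^μ), and everything of generations 7–9's census.  No new end-to-end theorem is stated.

## What is NOT delivered
(id-V); (osc-U); the `K`-bookkeeping that feeds `bch_torus`/`kernel_tower` into generation 10's capstone in one call (its
remaining binders are the unprinted ones); locality sharper than `B7Prop1Explicit`'s ((44) on all of `ℤ^d` — for a periodic
lift this is (44) on the whole torus); the case `T = L` of a single block per direction (a window wraps around the torus
and `zpos_eq_of_tcls_eq` fails — excluded by `T ≥ 2L`, which holds along the tower as soon as `M·L^K ≥ 2`); optimal
constants; anything d ≠ 4 specific beyond `tker_col_sum_four` / `kernel_tower` (all other statements hold for every `d`).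
NE7 remains NOT PRINTED and NOT PROVED; this leaf closes the index-convention gap between generations 10 and 11 and produces
the kernel and count binders, nothing more.

VERSIONS.  v1 (t4-ne7-p1 gen 12, p191691).  v1.1 (same generation, DOCSTRING-ONLY, per cross-read C-pv04g21-3 D1/D2):
the paraphrase "a torus or the whole space" (×4, attributed to B7 p. 18) withdrawn and re-sourced — torus ↦ B12
[Balaban1987RG1] p. 251 / (0.1) verbatim, "any lattice" ↦ B7 p. 18 / p. 19 verbatim, blocks ↦ B7 (2)–(3) p. 17 — and the
locator tags of `tcls` / `box` / `IsPeriodic` / `IsPeriodic.bavg` / `.bavg_coarse` / `blocks_tile` / `kernel_tower_geometric`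
retagged accordingly; (42) now quoted in its printed `U`-form (the `V`-transcription is `B7Prop1Explicit.bavg`); renders
B7 pp. 18–19 and B12 p. 251 re-read as images.  No declaration, statement or proof changed.
-/

noncomputable section

open scoped BigOperators
open NormedSpace Finset

namespace Literature.MathematicalPhysics.QuantumFieldTheory.Balaban1983to89.T4TermwiseTorus

open B7Prop1Explicit T4TermwiseBCH

export B7Prop1Explicit (Site)

variable {d : ℕ}

/-! ## §1 Translation covariance of parallel transport (9), the axial gauge function, and the average (42) -/

section Shift

variable {G : Type*} [Group G]

/-- Parallel transport (9) is translation-covariant: the holonomy of the translated configuration `x ↦ V(x + v)`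
along a word spelled from `x` is the holonomy of `V` along the same word spelled from `x + v`. [folklore] -/
theorem hol_shift (V : Site d → Fin d → G) (v : Site d) :
    ∀ (x : Site d) (w : List (Letter d)), hol (fun y κ => V (y + v) κ) x w = hol V (x + v) w
  | x, [] => by simp
  | x, l :: w => by
    rw [hol_cons, hol_cons, hol_shift V v (x + l.vec) w, add_right_comm]
    congr 1
    obtain ⟨μ, b⟩ := l
    cases b <;> simp [stepHol, Letter.vec, add_right_comm]

/-- The axial gauge function of B5 (1.7) / B7 p. 24 is translation-covariant. [folklore] -/
theorem axialFn_shift (V : Site d → Fin d → G) (v y x : Site d) :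
    axialFn (fun y κ => V (y + v) κ) y x = axialFn V (y + v) (x + v) := by
  simp only [axialFn, hol_shift, add_sub_add_right_eq_sub]

/-- The gauge action (8) is translation-covariant. [folklore] -/
theorem gaugeAct_shift (u : Site d → G) (V : Site d → Fin d → G) (v : Site d) :
    gaugeAct (fun y => u (y + v)) (fun y κ => V (y + v) κ) = fun y κ => gaugeAct u V (y + v) κ := by
  funext y κ
  simp [gaugeAct, add_right_comm]

end Shift

section ShiftAvg

variable {𝔸 : Type*} [NormedRing 𝔸] [NormedAlgebra ℂ 𝔸] [CompleteSpace 𝔸]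
variable (L : ℕ)

omit [NormedAlgebra ℂ 𝔸] [CompleteSpace 𝔸] in
/-- The argument `V(Γ_{c,x}) V(c)⁻¹` of the logarithm in (42) is translation-covariant. [folklore] -/
theorem Wcx_shift (V : Site d → Fin d → 𝔸ˣ) (v q : Site d) (κ : Fin d) (r : Site d) :
    Wcx L (fun y κ => V (y + v) κ) q κ r = Wcx L V (q + v) κ r := by
  simp only [Wcx, hol_shift]

omit [CompleteSpace 𝔸] in
/-- The exponent of (42) is translation-covariant. [folklore] -/
theorem Xavg_shift (V : Site d → Fin d → 𝔸ˣ) (v q : Site d) (κ : Fin d) :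
    Xavg L (fun y κ => V (y + v) κ) q κ = Xavg L V (q + v) κ := by
  simp only [Xavg, Wcx_shift]

/-- **(42) is translation-covariant**: the average of the translated configuration is the translated average,
`\overline{V(· + v)} = V̄(· + v)` (the contours `Γ_{c,x}`, `Γ_c` of (14)/(42) are defined by translation; print
p. 19 «In fact, Ω^{(j)} may be replaced by any other lattice.»). [cite: Balaban1985Averaging, (42) p.23] -/
theorem bavg_shift (V : Site d → Fin d → 𝔸ˣ) (v : Site d) :
    bavg L (fun y κ => V (y + v) κ) = fun q κ => bavg L V (q + v) κ := by
  funext q κ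
  apply Units.ext
  simp only [bavg, Units.val_mul, val_expUnit, Xavg_shift, hol_shift]

omit [NormedAlgebra ℂ 𝔸] [CompleteSpace 𝔸] in
/-- The coarse plaquette variable `W(∂p′)` is translation-covariant. [folklore] -/
theorem cplaq_shift (W : Site d → Fin d → 𝔸ˣ) (v z : Site d) (μ ν : Fin d) :
    cplaq L (fun y κ => W (y + v) κ) z μ ν = cplaq L W (z + v) μ ν := by
  simp only [cplaq, add_right_comm]

/-- `V̄(∂p′)` of the translated configuration is `V̄(∂(p′ + v))`. [cite: Balaban1985Averaging, (42) p.23] -/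
theorem cplaq_bavg_shift (V : Site d → Fin d → 𝔸ˣ) (v z : Site d) (μ ν : Fin d) :
    cplaq L (bavg L (fun y κ => V (y + v) κ)) z μ ν = cplaq L (bavg L V) (z + v) μ ν := by
  rw [bavg_shift, cplaq_shift]

end ShiftAvg


/-! ## §2 Torus classes `(ℤ/Tℤ)^d`, the box of representatives `[0,T)^d`, lifts -/

section Torus

variable (T : ℕ)

/-- The class of `x ∈ ℤ^d` on the torus `(ℤ/Tℤ)^d` (the torus of B12 p. 251 «Consider a lattice as a subset of a
continuous Euclidean space R^d, or a torus T obtained by the usual identification of boundary points of the cube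
{x ∈ R^d : −L_μ ≤ x_μ ≤ L_μ, μ = 1, …, d}», (0.1); `Setup`'s torus sites are `Fin d → ZMod ·`).
[cite: Balaban1987RG1, (0.1) p.251] -/
def tcls (x : Site d) : Fin d → ZMod T := fun κ => ((x κ : ℤ) : ZMod T)

/-- `tcls_apply` — bookkeeping. [folklore] -/
@[simp] theorem tcls_apply (x : Site d) (κ : Fin d) : tcls T x κ = ((x κ : ℤ) : ZMod T) := rfl

/-- `tcls_add` — bookkeeping. [folklore] -/
theorem tcls_add (x y : Site d) : tcls T (x + y) = tcls T x + tcls T y := by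
  funext κ; simp

/-- `tcls_period`: `T ℤ^d` is killed. [folklore] -/
theorem tcls_period (m : Site d) : tcls T ((T : ℤ) • m) = 0 := by
  funext κ; simp

/-- Two points of `ℤ^d` have the same torus class iff they differ by an element of `Tℤ^d`. [folklore] -/
theorem tcls_eq_tcls_iff {x y : Site d} : tcls T x = tcls T y ↔ ∃ m : Site d, y = x + (T : ℤ) • m := by
  constructor
  · intro h
    have h' : ∀ κ, (T : ℤ) ∣ y κ - x κ := fun κ =>
      (ZMod.intCast_eq_intCast_iff_dvd_sub (x κ) (y κ) T).1 (congr_fun h κ)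
    choose m hm using h'
    refine ⟨m, funext fun κ => ?_⟩
    have := hm κ
    simp only [Pi.add_apply, Pi.smul_apply, smul_eq_mul]
    linarith
  · rintro ⟨m, rfl⟩
    rw [tcls_add, tcls_period, add_zero]

/-- The box `[0, N)^d ⊂ ℤ^d` (the block (2) p. 17 of B7 / B5 (1.6) with corner `0` and side `N`): the standard
representatives of `(ℤ/Nℤ)^d`. [cite: Balaban1985Averaging, (2)–(3) p.17] -/
def box (N : ℕ) : Finset (Site d) := Finset.univ.image (boxVec N)

/-- `boxVec_injective` — bookkeeping. [folklore] -/
theorem boxVec_injective (N : ℕ) : Function.Injective (boxVec (d := d) N) := fun r r' h =>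
  funext fun κ => Fin.ext (by have := congr_fun h κ; simpa [boxVec] using this)

/-- `card_box`: `#[0,N)^d = N^d`. [folklore] -/
theorem card_box (N : ℕ) : (box (d := d) N).card = N ^ d := by
  rw [box, Finset.card_image_of_injective _ (boxVec_injective N), Finset.card_univ, Fintype.card_fun,
    Fintype.card_fin, Fintype.card_fin]

/-- `mem_box` — bookkeeping. [folklore] -/
theorem mem_box {N : ℕ} {x : Site d} : x ∈ box N ↔ ∀ κ, 0 ≤ x κ ∧ x κ < N := by
  simp only [box, Finset.mem_image, Finset.mem_univ, true_and]
  constructor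
  · rintro ⟨r, rfl⟩ κ
    exact ⟨by simp [boxVec], by simp [boxVec]⟩
  · intro h
    refine ⟨fun κ => ⟨(x κ).toNat, ?_⟩, funext fun κ => ?_⟩
    · have := h κ; omega
    · have := h κ; simp only [boxVec]; omega

/-- `boxVec_mem_box` — bookkeeping. [folklore] -/
theorem boxVec_mem_box {N : ℕ} (r : Fin d → Fin N) : boxVec N r ∈ box N :=
  Finset.mem_image.2 ⟨r, Finset.mem_univ _, rfl⟩

variable {T}

/-- The standard representative in `[0,T)^d` of a torus class. [folklore] -/
def tlift (ξ : Fin d → ZMod T) : Site d := fun κ => ((ξ κ).val : ℤ)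

/-- `tcls_tlift`: lifting then reducing is the identity. [folklore] -/
theorem tcls_tlift [NeZero T] (ξ : Fin d → ZMod T) : tcls T (tlift ξ) = ξ := by
  funext κ; simp [tlift]

/-- `tlift_mem_box`: representatives lie in the box. [folklore] -/
theorem tlift_mem_box [NeZero T] (ξ : Fin d → ZMod T) : tlift ξ ∈ box T :=
  mem_box.2 fun κ => ⟨Int.natCast_nonneg _, Int.ofNat_lt.2 (ZMod.val_lt (ξ κ))⟩

/-- `tlift_tcls_of_mem_box`: a point of the box is the representative of its class. [folklore] -/
theorem tlift_tcls_of_mem_box [NeZero T] {x : Site d} (hx : x ∈ box T) : tlift (tcls T x) = x := by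
  obtain ⟨r, -, rfl⟩ := Finset.mem_image.1 hx
  funext κ
  simp only [tlift, tcls_apply, boxVec, Int.cast_natCast, ZMod.val_natCast_of_lt (r κ).isLt]

/-- On the box, equality of classes is equality. [folklore] -/
theorem tcls_injOn_box [NeZero T] {x y : Site d} (hx : x ∈ box T) (hy : y ∈ box T) (h : tcls T x = tcls T y) :
    x = y := by
  rw [← tlift_tcls_of_mem_box hx, ← tlift_tcls_of_mem_box hy, h]

/-- For `x` in the box: `y` has the class of `x` iff `x` is the representative of `y`'s class. [folklore] -/
theorem tcls_eq_tcls_iff_tlift_eq [NeZero T] {x : Site d} (hx : x ∈ box T) (y : Site d) :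
    tcls T y = tcls T x ↔ tlift (tcls T y) = x := by
  constructor
  · intro h; rw [h, tlift_tcls_of_mem_box hx]
  · intro h; rw [← h, tcls_tlift]

end Torus

/-! ## §3 Periodicity: fields on the torus read on the universal cover `ℤ^d` -/

section Periodic

/-- `T`-periodicity in every coordinate direction of a field on `ℤ^d` — a field on the torus `(ℤ/Tℤ)^d` (the torus
of B12 (0.1) p. 251) read on the universal cover, so that the contours (9), (14) and the average (42), formalised on `ℤ^d`
in `B7Prop1Explicit`, apply verbatim (B7 p. 19 «In fact, Ω^{(j)} may be replaced by any other lattice.»).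
[cite: Balaban1987RG1, (0.1) p.251] -/
def IsPeriodic (T : ℕ) {β : Sort*} (F : Site d → β) : Prop := ∀ x m : Site d, F (x + (T : ℤ) • m) = F x

variable {T : ℕ} {β : Sort*} {F : Site d → β}

/-- A periodic field depends only on the torus class. [folklore] -/
theorem IsPeriodic.eq_of_tcls_eq (hF : IsPeriodic T F) {x y : Site d} (h : tcls T x = tcls T y) : F x = F y := by
  obtain ⟨m, rfl⟩ := (tcls_eq_tcls_iff T).1 h
  exact (hF x m).symm

/-- A periodic field at `x` is its value at the representative of the class of `x`. [folklore] -/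
theorem IsPeriodic.apply_tlift [NeZero T] (hF : IsPeriodic T F) (x : Site d) : F (tlift (tcls T x)) = F x :=
  hF.eq_of_tcls_eq (tcls_tlift _)

/-- DESCENT: a periodic field is the pull-back of a (unique) field on the torus, namely `ξ ↦ F (tlift ξ)`. [folklore] -/
theorem IsPeriodic.descends [NeZero T] (hF : IsPeriodic T F) : ∃! f : (Fin d → ZMod T) → β, ∀ x, F x = f (tcls T x) := by
  refine ⟨fun ξ => F (tlift ξ), fun x => (hF.apply_tlift x).symm, fun g hg => funext fun ξ => ?_⟩
  rw [hg (tlift ξ), tcls_tlift]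

variable {G : Type*} [Group G] {V : Site d → Fin d → G}

/-- Parallel transports (9) of a periodic configuration are periodic. [folklore] -/
theorem IsPeriodic.hol (hV : IsPeriodic T V) (w : List (Letter d)) : IsPeriodic T fun x => hol V x w := fun x m => by
  have hfun : (fun y κ => V (y + (T : ℤ) • m) κ) = V := funext fun y => funext fun κ => by rw [hV y m]
  beta_reduce
  rw [← hol_shift V ((T : ℤ) • m) x w, hfun]

/-- The axial gauge function of a periodic configuration is jointly periodic. [folklore] -/
theorem IsPeriodic.axialFn (hV : IsPeriodic T V) (y x m : Site d) :
    axialFn V (y + (T : ℤ) • m) (x + (T : ℤ) • m) = axialFn V y x := by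
  have hfun : (fun y κ => V (y + (T : ℤ) • m) κ) = V := funext fun y => funext fun κ => by rw [hV y m]
  rw [← axialFn_shift V ((T : ℤ) • m) y x, hfun]

/-- The gauge transform of a periodic configuration by a periodic gauge function is periodic. [folklore] -/
theorem IsPeriodic.gaugeAct {u : Site d → G} (hu : IsPeriodic T u) (hV : IsPeriodic T V) :
    IsPeriodic T (gaugeAct u V) := fun x m => by
  funext κ
  simp only [B7Prop1Explicit.gaugeAct, hu x m, hV x m]
  rw [add_right_comm, hu (x + e κ) m]

variable {𝔸 : Type*} [NormedRing 𝔸] [NormedAlgebra ℂ 𝔸] [CompleteSpace 𝔸] (L : ℕ)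
  {V : Site d → Fin d → 𝔸ˣ}

/-- **The average (42) of a periodic configuration is periodic** (with the same period): (42) is defined on the
torus. [cite: Balaban1985Averaging, (42) p.23] [cite: Balaban1987RG1, (0.1) p.251] -/
theorem IsPeriodic.bavg (hV : IsPeriodic T V) : IsPeriodic T (bavg L V) := fun x m => by
  have hfun : (fun y κ => V (y + (T : ℤ) • m) κ) = V := funext fun y => funext fun κ => by rw [hV y m]
  funext κ
  have := congr_fun (congr_fun (bavg_shift L V ((T : ℤ) • m)) x) κ
  rw [hfun] at this
  exact this.symm

omit [NormedAlgebra ℂ 𝔸] [CompleteSpace 𝔸] in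
/-- Coarse plaquette variables of a periodic configuration are periodic. [folklore] -/
theorem IsPeriodic.cplaq {W : Site d → Fin d → 𝔸ˣ} (hW : IsPeriodic T W) (μ ν : Fin d) :
    IsPeriodic T fun z => cplaq L W z μ ν := fun x m => by
  have hfun : (fun y κ => W (y + (T : ℤ) • m) κ) = W := funext fun y => funext fun κ => by rw [hW y m]
  show B7Prop1Explicit.cplaq L W (x + (T : ℤ) • m) μ ν = B7Prop1Explicit.cplaq L W x μ ν
  rw [← cplaq_shift L W ((T : ℤ) • m) x μ ν, hfun]

/-- **The averaged configuration lives on the coarse torus**: for `T = nL`, the `L`-lattice field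
`a ↦ V̄(La, κ)` of a `T`-periodic `V` is `n`-periodic. [cite: Balaban1985Averaging, (42) p.23]
[cite: Balaban1987RG1, (0.1) p.251] -/
theorem IsPeriodic.bavg_coarse {n : ℕ} (hT : T = n * L) (hV : IsPeriodic T V) :
    IsPeriodic n fun a : Site d => B7Prop1Explicit.bavg L V ((L : ℤ) • a) := fun a m => by
  have h1 : (L : ℤ) • (a + (n : ℤ) • m) = (L : ℤ) • a + (T : ℤ) • ((1 : ℤ) • m) := by
    rw [hT, smul_add, smul_smul, smul_smul, Nat.cast_mul]; congr 1; ring_nf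
  show B7Prop1Explicit.bavg L V ((L : ℤ) • (a + (n : ℤ) • m)) = B7Prop1Explicit.bavg L V ((L : ℤ) • a)
  rw [h1, hV.bavg L]

end Periodic


/-! ## §4 Window slots and positions; blocks tile the torus; the torus slot count `L²` -/

section Slots

variable (L : ℕ)

/-- The SLOTS of one block-averaging window of (42)/(47): an offset `r ∈ [0,L)^d` (the point `x′ = y₀ + r ∈ B(y₀)`)
together with the place `(i, j) ∈ [0,L)²` of a unit plaquette `p ⊂ (p′)_{x′}` in the `L × L` plaquette `(p′)_{x′}`
— the index set of the triple sum of `T4TermwiseBCH.bch_concrete` / `window_sum_eq_position_sum`.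
[cite: Balaban1985Averaging, (47) p.25] -/
def slots : Finset ((Fin d → Fin L) × ℕ × ℕ) := Finset.univ ×ˢ (Finset.range L ×ˢ Finset.range L)

/-- `mem_slots` — bookkeeping. [folklore] -/
theorem mem_slots {s : (Fin d → Fin L) × ℕ × ℕ} : s ∈ slots L ↔ s.2.1 < L ∧ s.2.2 < L := by
  simp [slots]

/-- `card_slots`: a window has `L^d · L²` slots. [folklore] -/
theorem card_slots : (slots (d := d) L).card = L ^ d * (L * L) := by
  simp [slots, Finset.card_product]

/-- The POSITION (lower-left corner `p₋` of the unit plaquette `p`) of a slot of the window with corner `z = y₀` in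
the plane `(μ, ν)`: `z + r + i e_μ + j e_ν` — the points `x r i j` of `T4TermwiseBCH.bch_concrete` (`hx`).
[cite: Balaban1985Averaging, (47)–(48) p.25] -/
def zpos (μ ν : Fin d) (z : Site d) (s : (Fin d → Fin L) × ℕ × ℕ) : Site d :=
  z + boxVec L s.1 + (s.2.1 : ℤ) • e μ + (s.2.2 : ℤ) • e ν

/-- `zpos_mk` — bookkeeping: the positions are generation 11's `x r i j`. [folklore] -/
theorem zpos_mk (μ ν : Fin d) (z : Site d) (r : Fin d → Fin L) (i j : ℕ) :
    zpos L μ ν z (r, i, j) = z + boxVec L r + (i : ℤ) • e μ + (j : ℤ) • e ν := rfl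

/-- `zpos_add_corner` — positions move with the corner. [folklore] -/
theorem zpos_add_corner (μ ν : Fin d) (z v : Site d) (s : (Fin d → Fin L) × ℕ × ℕ) :
    zpos L μ ν (z + v) s = zpos L μ ν z s + v := by
  simp only [zpos]; abel

/-- `tcls_zpos` — the class of a position splits as (corner + offset) + (place in the window). [folklore] -/
theorem tcls_zpos (T : ℕ) (μ ν : Fin d) (z : Site d) (s : (Fin d → Fin L) × ℕ × ℕ) :
    tcls T (zpos L μ ν z s) = tcls T (z + boxVec L s.1) + tcls T ((s.2.1 : ℤ) • e μ + (s.2.2 : ℤ) • e ν) := by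
  rw [zpos, ← tcls_add]; congr 1; abel

/-- The coordinates of a window position relative to the corner lie in `[0, 2L − 2]` (plane `μ ≠ ν`). [folklore] -/
theorem zpos_sub_corner_bounds {μ ν : Fin d} (hμν : μ ≠ ν) (z : Site d) {s : (Fin d → Fin L) × ℕ × ℕ}
    (hs : s ∈ slots L) (κ : Fin d) : 0 ≤ zpos L μ ν z s κ - z κ ∧ zpos L μ ν z s κ - z κ ≤ 2 * (L : ℤ) - 2 := by
  rw [mem_slots] at hs
  have hr := (s.1 κ).isLt
  simp only [zpos, Pi.add_apply, Pi.smul_apply, smul_eq_mul, boxVec, e, Pi.single_apply, mul_ite, mul_one, mul_zero]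
  by_cases h1 : κ = μ
  · have h2 : ¬κ = ν := fun h => hμν (h1 ▸ h)
    rw [if_pos h1, if_neg h2]; omega
  · by_cases h2 : κ = ν
    · rw [if_neg h1, if_pos h2]; omega
    · rw [if_neg h1, if_neg h2]; omega

/-- **Window positions are distinct on the torus as soon as `T ≥ 2L`**: two slots of one window whose positions agree
mod `T` have the same position in `ℤ^d` (a window spans at most `2L − 1 < T` sites in each direction). [folklore] -/
theorem zpos_eq_of_tcls_eq {T : ℕ} (h2L : 2 * L ≤ T) {μ ν : Fin d} (hμν : μ ≠ ν) (z : Site d)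
    {s s' : (Fin d → Fin L) × ℕ × ℕ} (hs : s ∈ slots L) (hs' : s' ∈ slots L)
    (h : tcls T (zpos L μ ν z s) = tcls T (zpos L μ ν z s')) : zpos L μ ν z s = zpos L μ ν z s' := by
  obtain ⟨m, hm⟩ := (tcls_eq_tcls_iff T).1 h
  funext κ
  have hb := zpos_sub_corner_bounds L hμν z hs κ
  have hb' := zpos_sub_corner_bounds L hμν z hs' κ
  have hκ : zpos L μ ν z s' κ = zpos L μ ν z s κ + (T : ℤ) * m κ := by
    have := congr_fun hm κ; simpa using this
  have hdvd : (T : ℤ) ∣ zpos L μ ν z s' κ - zpos L μ ν z s κ := ⟨m κ, by rw [hκ]; ring⟩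
  have habs : |zpos L μ ν z s' κ - zpos L μ ν z s κ| < (T : ℤ) := by
    rw [abs_lt]; constructor <;> omega
  have := Int.eq_zero_of_abs_lt_dvd hdvd habs
  omega

/-- **Blocks tile the torus** (mixed-radix digits): for `T = nL > 0`, `(a, r) ↦ (La + r) mod T` is a bijection from
(block index `a ∈ [0,n)^d`) × (offset `r ∈ [0,L)^d`) onto `(ℤ/Tℤ)^d` — every torus point lies in exactly one block
`B(La)` (the blocks `B(y)` of B7 (2) p. 17 / B5 (1.6)). [cite: Balaban1985Averaging, (2)–(3) p.17]
[cite: Balaban1987RG1, (0.1) p.251] -/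
theorem blocks_tile {n T : ℕ} (hT : T = n * L) (hT0 : 0 < T) :
    Function.Bijective fun ar : (Fin d → Fin n) × (Fin d → Fin L) =>
      tcls T ((L : ℤ) • boxVec n ar.1 + boxVec L ar.2) := by
  haveI : NeZero T := ⟨hT0.ne'⟩
  have hL0 : 0 < L := Nat.pos_of_ne_zero fun h => by subst h; simp at hT; omega
  have hval : ∀ (b : Fin n) (c : Fin L), L * (b : ℕ) + c < T := fun b c => by
    have h1 : L * ((b : ℕ) + 1) ≤ L * n := Nat.mul_le_mul_left _ b.isLt
    rw [hT, mul_comm n L]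
    have := c.isLt
    rw [mul_add_one] at h1
    omega
  have hF : ∀ (ar : (Fin d → Fin n) × (Fin d → Fin L)) (κ : Fin d),
      tcls T ((L : ℤ) • boxVec n ar.1 + boxVec L ar.2) κ = ((L * (ar.1 κ : ℕ) + (ar.2 κ : ℕ) : ℕ) : ZMod T) := by
    intro ar κ; simp [boxVec]
  rw [Fintype.bijective_iff_injective_and_card]
  constructor
  · rintro ⟨b, c⟩ ⟨b', c'⟩ h
    have hκ : ∀ κ, L * (b κ : ℕ) + (c κ : ℕ) = L * (b' κ : ℕ) + (c' κ : ℕ) := fun κ => by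
      have h1 := congr_fun h κ
      beta_reduce at h1
      rw [hF, hF, ZMod.natCast_eq_natCast_iff', Nat.mod_eq_of_lt (hval _ _), Nat.mod_eq_of_lt (hval _ _)] at h1
      exact h1
    have hb : ∀ κ, (b κ : ℕ) = b' κ := fun κ => by
      have e1 := hκ κ
      have hc := (c κ).isLt
      have hc' := (c' κ).isLt
      rcases lt_trichotomy (b κ : ℕ) (b' κ) with hlt | heq | hgt
      · exfalso
        have h2 : L * ((b κ : ℕ) + 1) ≤ L * (b' κ : ℕ) := Nat.mul_le_mul_left _ hlt
        rw [mul_add_one] at h2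
        omega
      · exact heq
      · exfalso
        have h2 : L * ((b' κ : ℕ) + 1) ≤ L * (b κ : ℕ) := Nat.mul_le_mul_left _ hgt
        rw [mul_add_one] at h2
        omega
    have hc : ∀ κ, (c κ : ℕ) = c' κ := fun κ => by
      have e1 := hκ κ; rw [hb κ] at e1; omega
    exact Prod.ext (funext fun κ => Fin.ext (hb κ)) (funext fun κ => Fin.ext (hc κ))
  · simp [Fintype.card_prod, ZMod.card, hT, mul_pow]

/-- **THE TORUS SLOT COUNT.** On `(ℤ/Tℤ)^d` with `T = nL > 0`, in any plane `(μ, ν)`: every torus point `ξ` is the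
position of EXACTLY `L²` slots `(a, x′ ∈ B(La), p ⊂ (p′)_{x′})`, counted over all blocks `a ∈ [0,n)^d` — for each of
the `L²` places `(i, j)` of `p` inside an `L × L` window there is exactly one window whose `(i, j)`-th plaquette sits at
`ξ` (blocks tile the torus).  This is the incidence count behind Prop. 1 (51)'s leading coefficient read from the FINE
side: the column sums of the averaging kernel. [cite: Balaban1985Averaging, (47) p.25, (51) p.26] -/
theorem slot_count {n T : ℕ} (hT : T = n * L) (hT0 : 0 < T) (μ ν : Fin d) (ξ : Fin d → ZMod T) :
    ((Finset.univ ×ˢ slots L).filter (fun p : (Fin d → Fin n) × ((Fin d → Fin L) × ℕ × ℕ) =>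
        tcls T (zpos L μ ν ((L : ℤ) • boxVec n p.1) p.2) = ξ)).card = L ^ 2 := by
  classical
  have hbij := blocks_tile L hT hT0 (d := d)
  have hdec : ∀ (a : Fin d → Fin n) (s : (Fin d → Fin L) × ℕ × ℕ),
      tcls T (zpos L μ ν ((L : ℤ) • boxVec n a) s)
        = (fun ar : (Fin d → Fin n) × (Fin d → Fin L) => tcls T ((L : ℤ) • boxVec n ar.1 + boxVec L ar.2)) (a, s.1)
          + tcls T ((s.2.1 : ℤ) • e μ + (s.2.2 : ℤ) • e ν) := fun a s => tcls_zpos L T μ ν _ s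
  rw [show L ^ 2 = (Finset.range L ×ˢ Finset.range L).card by simp [sq]]
  refine Finset.card_bij (fun p _ => p.2.2) (fun p hp => ?_) (fun p hp p' hp' h => ?_) (fun ij hij => ?_)
  · simp only [Finset.mem_filter, Finset.mem_product, Finset.mem_univ, true_and, slots] at hp
    exact Finset.mem_product.2 hp.1
  · simp only [Finset.mem_filter] at hp hp'
    have e1 := hp.2
    have e2 := hp'.2
    rw [hdec] at e1 e2
    rw [h] at e1
    have hh := hbij.1 (add_right_cancel (e1.trans e2.symm))
    obtain ⟨a, r, ij⟩ := p
    obtain ⟨a', r', ij'⟩ := p'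
    simp only [Prod.mk.injEq] at hh h ⊢
    exact ⟨hh.1, hh.2, h⟩
  · obtain ⟨⟨a, r⟩, har⟩ := hbij.2 (ξ - tcls T ((ij.1 : ℤ) • e μ + (ij.2 : ℤ) • e ν))
    refine ⟨(a, r, ij), ?_, rfl⟩
    simp only [Finset.mem_filter, Finset.mem_product, Finset.mem_univ, true_and, slots]
    refine ⟨Finset.mem_product.1 hij, ?_⟩
    rw [hdec]
    simp only at har ⊢
    rw [har, sub_add_cancel]

end Slots

/-! ## §5 The torus averaging kernel: `w ≥ 0`, row sums `L²`, column sums `L^{2−d}` (`= L⁻²` in `d = 4`) -/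

section Kernel

variable (T L : ℕ) (μ ν : Fin d)

/-- THE TORUS AVERAGING KERNEL of (42)/(47) in the plane `(μ, ν)`: the weight of the fine plaquette at `x` (mod `T`)
in the coarse plaquette `p′` with corner `La` is `L^{−d} · #{slots (x′ ∈ B(La), p ⊂ (p′)_{x′}) sitting at x mod T}` —
generation 10's `w K y x` (`T4TermwiseQuartic.interpolation_averaging_of_regular`), PRODUCED.
[cite: Balaban1985Averaging, (42) p.23, (47) p.25] -/
def tker (a x : Site d) : ℝ :=
  ((L : ℝ) ^ d)⁻¹ * (((slots L).filter fun s => tcls T (zpos L μ ν ((L : ℤ) • a) s) = tcls T x).card : ℝ)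

/-- (ker), SIGN: `w ≥ 0` — generation 10's `hw`. [folklore] -/
theorem tker_nonneg (a x : Site d) : 0 ≤ tker T L μ ν a x := by
  unfold tker; positivity

/-- (ker), SUPPORT: a fine plaquette with non-zero weight in `p′` is (mod `T`) the position of a slot of the window of
`p′` — the locality behind the (osc) binder (`0 < w y x → …`). [folklore] -/
theorem exists_slot_of_tker_ne_zero {a x : Site d} (h : tker T L μ ν a x ≠ 0) :
    ∃ s ∈ slots L, tcls T (zpos L μ ν ((L : ℤ) • a) s) = tcls T x := by
  by_contra hne
  apply h
  rw [tker, Finset.filter_eq_empty_iff.2 (fun s hs hP => hne ⟨s, hs, hP⟩), Finset.card_empty, Nat.cast_zero,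
    mul_zero]

/-- **(ker), ROW SUM = `L²`** on the torus `(ℤ/Tℤ)^d` (fine plaquettes indexed by the box of representatives
`[0,T)^d`): every one of the `L^d · L²` slots of the window sits at exactly one representative — generation 10's
`hrow`, the leading coefficient of Prop. 1 (51). [cite: Balaban1985Averaging, (51) p.26] -/
theorem tker_row_sum (hT0 : 0 < T) (hL : 0 < L) (a : Site d) : ∑ x ∈ box T, tker T L μ ν a x = (L : ℝ) ^ 2 := by
  haveI : NeZero T := ⟨hT0.ne'⟩
  unfold tker
  rw [← Finset.mul_sum, ← Nat.cast_sum]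
  have hfib : ∑ x ∈ box T, ((slots L).filter fun s => tcls T (zpos L μ ν ((L : ℤ) • a) s) = tcls T x).card
      = (slots (d := d) L).card := by
    rw [Finset.card_eq_sum_card_fiberwise (f := fun s => tlift (tcls T (zpos L μ ν ((L : ℤ) • a) s)))
      (t := box T) (fun s _ => tlift_mem_box _)]
    refine Finset.sum_congr rfl fun x hx => ?_
    congr 1
    ext s
    simp only [Finset.mem_filter, tcls_eq_tcls_iff_tlift_eq hx]
  rw [hfib, card_slots]
  have hLd : ((L : ℝ)) ^ d ≠ 0 := pow_ne_zero _ (by exact_mod_cast hL.ne')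
  push_cast
  rw [← mul_assoc, inv_mul_cancel₀ hLd, one_mul, sq]

/-- **(ker), COLUMN SUM = `L^{2−d}`** on the torus with `T = nL` (coarse plaquettes indexed by the block indices
`a ∈ [0,n)^d`): every fine plaquette carries total weight `L^{−d} · L²` — the torus slot count `slot_count`.
[cite: Balaban1985Averaging, (47) p.25, (51) p.26] -/
theorem tker_col_sum {n : ℕ} (hT : T = n * L) (hT0 : 0 < T) (x : Site d) :
    ∑ a ∈ box n, tker T L μ ν a x = ((L : ℝ) ^ d)⁻¹ * (L : ℝ) ^ 2 := by
  classical
  have hcount : ∑ a ∈ box n, ((slots L).filter fun s => tcls T (zpos L μ ν ((L : ℤ) • a) s) = tcls T x).card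
      = L ^ 2 := by
    rw [box, Finset.sum_image fun r _ r' _ h => boxVec_injective n h, ← slot_count L hT hT0 μ ν (tcls T x),
      Finset.card_filter, Finset.sum_product]
    refine Finset.sum_congr rfl fun a _ => ?_
    rw [Finset.card_filter]
  unfold tker
  rw [← Finset.mul_sum, ← Nat.cast_sum, hcount, Nat.cast_pow]

/-- **(ker), COLUMN SUM in `d = 4`: `L⁻²`** — generation 10's `hcol : Σ_y w y x = (L²)⁻¹`, literally.
[cite: Balaban1985Averaging, (51) p.26] -/
theorem tker_col_sum_four {n T L : ℕ} (hT : T = n * L) (hT0 : 0 < T) (μ ν : Fin 4) (x : Site 4) :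
    ∑ a ∈ box n, tker T L μ ν a x = ((L : ℝ) ^ 2)⁻¹ := by
  have hL0 : 0 < L := Nat.pos_of_ne_zero fun h => by subst h; simp at hT; omega
  rw [tker_col_sum T L μ ν hT hT0 x]
  have hLr : (L : ℝ) ≠ 0 := by exact_mod_cast hL0.ne'
  field_simp

end Kernel


/-! ## §5b Plane labels (block-diagonal kernel) and the tower-indexed form of generation 10's binders (d = 4) -/

section Planes

variable (T L : ℕ) (planes : Finset (Fin d × Fin d))

/-- Plane-labelled plaquette index sets `(plane (μ, ν), point of [0,N)^d)` — generation 10's `Pf K` / `Pc K` as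
finsets of the FIXED type `(Fin d × Fin d) × ℤ^d` (representatives, so that the type does not vary along the tower).
[folklore] -/
def pbox (N : ℕ) : Finset ((Fin d × Fin d) × Site d) := planes ×ˢ box N

/-- **(cnt)**: `#(planes × [0,N)^d) = #planes · N^d` — generation 10's `hNf`/`hNc` with EQUALITY
(`n₀ = #planes`, e.g. `6` in `d = 4`; `N^d = vol · (L^{K+1})^d` resp. `vol · (L^K)^d`). [folklore] -/
theorem card_pbox (N : ℕ) : (pbox planes N).card = planes.card * N ^ d := by
  rw [pbox, Finset.card_product, card_box]

/-- The plane-block-diagonal torus averaging kernel: a coarse plaquette only sees fine plaquettes of its own plane.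
[cite: Balaban1985Averaging, (47) p.25] -/
def pker (y x : (Fin d × Fin d) × Site d) : ℝ := if y.1 = x.1 then tker T L y.1.1 y.1.2 y.2 x.2 else 0

/-- (ker), SIGN for the plane-labelled kernel. [folklore] -/
theorem pker_nonneg (y x : (Fin d × Fin d) × Site d) : 0 ≤ pker T L y x := by
  unfold pker; split_ifs
  · exact tker_nonneg ..
  · exact le_rfl

/-- (ker), ROW SUM `L²` for the plane-labelled kernel. [cite: Balaban1985Averaging, (51) p.26] -/
theorem pker_row_sum (hT0 : 0 < T) (hL : 0 < L) {n : ℕ} {y : (Fin d × Fin d) × Site d} (hy : y ∈ pbox planes n) :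
    ∑ x ∈ pbox planes T, pker T L y x = (L : ℝ) ^ 2 := by
  have hy1 : y.1 ∈ planes := (Finset.mem_product.1 hy).1
  rw [pbox, Finset.sum_product]
  have key : ∀ π ∈ planes, ∑ x ∈ box T, pker T L y (π, x) = if y.1 = π then (L : ℝ) ^ 2 else 0 := by
    intro π _
    by_cases h : y.1 = π
    · simp only [pker, h, if_true]
      exact tker_row_sum T L _ _ hT0 hL _
    · simp only [pker, h, if_false, Finset.sum_const_zero]
  rw [Finset.sum_congr rfl key, Finset.sum_ite_eq, if_pos hy1]

/-- (ker), COLUMN SUM `L^{2−d}` for the plane-labelled kernel, `T = nL`. [cite: Balaban1985Averaging, (51) p.26] -/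
theorem pker_col_sum {n : ℕ} (hT : T = n * L) (hT0 : 0 < T) {x : (Fin d × Fin d) × Site d}
    (hx : x ∈ pbox planes T) : ∑ y ∈ pbox planes n, pker T L y x = ((L : ℝ) ^ d)⁻¹ * (L : ℝ) ^ 2 := by
  have hx1 : x.1 ∈ planes := (Finset.mem_product.1 hx).1
  rw [pbox, Finset.sum_product]
  have key : ∀ π ∈ planes, ∑ a ∈ box n, pker T L (π, a) x
      = if π = x.1 then ((L : ℝ) ^ d)⁻¹ * (L : ℝ) ^ 2 else 0 := by
    intro π _
    by_cases h : π = x.1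
    · simp only [pker, h, if_true]
      exact tker_col_sum T L _ _ hT hT0 _
    · simp only [pker, h, if_false, Finset.sum_const_zero]
  rw [Finset.sum_congr rfl key, Finset.sum_ite_eq', if_pos hx1]

/-- The plane-labelled kernel sum is the per-plane kernel sum: `Σ_{x ∈ planes × [0,T)^d} pker y x • F x =
Σ_{x ∈ [0,T)^d} tker (plane of y) y.2 x • F (y.1, x)` for `y.1 ∈ planes` — so every per-plane statement below
(`bch_torus`, `norm_textend_transport`) is generation 10's plane-labelled binder over `Pf = pbox planes T`. [folklore] -/
theorem pker_sum_eq {M : Type*} [AddCommMonoid M] [Module ℝ M] {y : (Fin d × Fin d) × Site d} (hy : y.1 ∈ planes)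
    (F : (Fin d × Fin d) × Site d → M) :
    ∑ x ∈ pbox planes T, pker T L y x • F x = ∑ x ∈ box T, tker T L y.1.1 y.1.2 y.2 x • F (y.1, x) := by
  rw [pbox, Finset.sum_product]
  have key : ∀ π ∈ planes, ∑ x ∈ box T, pker T L y (π, x) • F (π, x)
      = if y.1 = π then ∑ x ∈ box T, tker T L y.1.1 y.1.2 y.2 x • F (y.1, x) else 0 := by
    intro π _
    by_cases h : y.1 = π
    · subst h
      simp only [pker, if_true]
    · simp only [pker, h, if_false, zero_smul, Finset.sum_const_zero]
  rw [Finset.sum_congr rfl key, Finset.sum_ite_eq, if_pos hy]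

/-- (ker), COLUMN SUM in `d = 4`: `(L²)⁻¹`, plane-labelled. [cite: Balaban1985Averaging, (51) p.26] -/
theorem pker_col_sum_four {T L n : ℕ} (planes : Finset (Fin 4 × Fin 4)) (hT : T = n * L) (hT0 : 0 < T)
    {x : (Fin 4 × Fin 4) × Site 4} (hx : x ∈ pbox planes T) :
    ∑ y ∈ pbox planes n, pker T L y x = ((L : ℝ) ^ 2)⁻¹ := by
  have hL0 : 0 < L := Nat.pos_of_ne_zero fun h => by subst h; simp at hT; omega
  rw [pker_col_sum T L planes hT hT0 hx]
  have hLr : (L : ℝ) ≠ 0 := by exact_mod_cast hL0.ne'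
  field_simp

/-- **(ker) + (cnt) PRODUCED ALONG THE TOWER in `d = 4`, in the literal shape of generation 10's binders
`hw`, `hrow`, `hcol`, `hNf`, `hNc` of `T4TermwiseQuartic.interpolation_averaging_of_regular`**: at tower level `K` the
fine torus has `n_K · L` sites per direction and the coarse one `n_K` (any `n_K ≥ 1`; Bałaban's tower: `n_K = M·L^K`
for a torus of `M^4` unit blocks, see `kernel_tower_geometric`), `Pf K = planes × [0, n_K L)^4`,
`Pc K = planes × [0, n_K)^4`, `w K = pker (n_K L) L`.  Finite volume throughout (HONEST FRAMING).
[cite: Balaban1985Averaging, (42) p.23, (47) p.25, (51) p.26] -/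
theorem kernel_tower (L : ℕ) (hL : 0 < L) (n : ℕ → ℕ) (hn : ∀ K, 0 < n K) (planes : Finset (Fin 4 × Fin 4)) :
    (∀ K, ∀ y ∈ pbox planes (n K), ∀ x ∈ pbox planes (n K * L), 0 ≤ pker (n K * L) L y x) ∧
    (∀ K, ∀ y ∈ pbox planes (n K), ∑ x ∈ pbox planes (n K * L), pker (n K * L) L y x = (L : ℝ) ^ 2) ∧
    (∀ K, ∀ x ∈ pbox planes (n K * L), ∑ y ∈ pbox planes (n K), pker (n K * L) L y x = ((L : ℝ) ^ 2)⁻¹) ∧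
    (∀ K, ((pbox planes (n K * L)).card : ℝ) = planes.card * ((n K : ℝ) * L) ^ 4) ∧
    (∀ K, ((pbox planes (n K)).card : ℝ) = planes.card * (n K : ℝ) ^ 4) := by
  have hT0 : ∀ K, 0 < n K * L := fun K => Nat.mul_pos (hn K) hL
  refine ⟨fun K y _ x _ => pker_nonneg _ _ y x, fun K y hy => pker_row_sum _ _ planes (hT0 K) hL hy,
    fun K x hx => pker_col_sum_four planes rfl (hT0 K) hx, fun K => ?_, fun K => ?_⟩
  · rw [card_pbox]; push_cast; ring
  · rw [card_pbox]; push_cast; ring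

/-- The same with Bałaban's geometric tower `n_K = M · L^K` (a torus of `M^4` unit cubes, lattice spacings
`L^{−(K+1)}` (fine) and `L^{−K}` (coarse) at level `K`): the counts are `#planes · M^4 · (L^{K+1})^4` and
`#planes · M^4 · (L^K)^4` — generation 10's `hNf`/`hNc` with `n₀ = #planes`, `vol = M^4`, and EQUALITY.
[cite: Balaban1985Averaging, (42) p.23] [cite: Balaban1987RG1, (0.1) p.251] -/
theorem kernel_tower_geometric (M L : ℕ) (hM : 0 < M) (hL : 0 < L) (planes : Finset (Fin 4 × Fin 4)) :
    (∀ K, ∀ y ∈ pbox planes (M * L ^ K), ∀ x ∈ pbox planes (M * L ^ K * L), 0 ≤ pker (M * L ^ K * L) L y x) ∧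
    (∀ K, ∀ y ∈ pbox planes (M * L ^ K), ∑ x ∈ pbox planes (M * L ^ K * L), pker (M * L ^ K * L) L y x
      = (L : ℝ) ^ 2) ∧
    (∀ K, ∀ x ∈ pbox planes (M * L ^ K * L), ∑ y ∈ pbox planes (M * L ^ K), pker (M * L ^ K * L) L y x
      = ((L : ℝ) ^ 2)⁻¹) ∧
    (∀ K, ((pbox planes (M * L ^ K * L)).card : ℝ) = planes.card * (M : ℝ) ^ 4 * ((L : ℝ) ^ (K + 1)) ^ 4) ∧
    (∀ K, ((pbox planes (M * L ^ K)).card : ℝ) = planes.card * (M : ℝ) ^ 4 * ((L : ℝ) ^ K) ^ 4) := by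
  obtain ⟨h1, h2, h3, h4, h5⟩ := kernel_tower L hL (fun K => M * L ^ K) (fun K => Nat.mul_pos hM (pow_pos hL K)) planes
  refine ⟨h1, h2, h3, fun K => ?_, fun K => ?_⟩
  · rw [h4 K]; push_cast; ring
  · rw [h5 K]; push_cast; ring

end Planes

/-! ## §6 The (bch) binder in KERNEL FORM on the torus: generation 11's `bch_concrete` re-indexed -/

section TorusTransport

variable (T L : ℕ) (μ ν : Fin d)

open Classical in
/-- TORUS EXTENSION of a window field: given the transported field `G` on the window positions `x′` (in `ℤ^d`) of
the coarse plaquette with corner `z` and a default field `D`, the field `Φ(p′, ·)` on ALL fine plaquettes `x`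
(representatives): `G` at the window position congruent to `x` mod `T` if there is one (unique as a point of `ℤ^d`
when `T ≥ 2L`, `zpos_eq_of_tcls_eq`), else `D x` — generation 10's `ΦA K t τ v y x`, which is quantified over all
`x ∈ Pf K`. [folklore] -/
def textend {M : Sort*} (z : Site d) (G D : Site d → M) (x : Site d) : M :=
  if h : ∃ s ∈ slots L, tcls T (zpos L μ ν z s) = tcls T x then G (zpos L μ ν z (Classical.choose h)) else D x

/-- At a fine plaquette of non-zero weight the torus extension IS the window field at a slot position of that
window (locality of (osc): two such plaquettes are positions of ONE window, `≤ 2L − 2` apart in each direction).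
[folklore] -/
theorem textend_of_tker_ne_zero {M : Sort*} {a x : Site d} (G D : Site d → M) (h : tker T L μ ν a x ≠ 0) :
    ∃ s ∈ slots L, tcls T (zpos L μ ν ((L : ℤ) • a) s) = tcls T x ∧
      textend T L μ ν ((L : ℤ) • a) G D x = G (zpos L μ ν ((L : ℤ) • a) s) := by
  have h' := exists_slot_of_tker_ne_zero T L μ ν h
  refine ⟨Classical.choose h', (Classical.choose_spec h').1, (Classical.choose_spec h').2, ?_⟩
  unfold textend
  rw [dif_pos h']

/-- (tr) for the torus extension: if the window field has the norm of the default field at congruent points, the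
extension has the norm of the default field EVERYWHERE — generation 10's `hΦA : ‖ΦA y x‖ = ‖φA x‖` for all
`y ∈ Pc`, `x ∈ Pf`. [folklore] -/
theorem norm_textend {M : Type*} [Norm M] (z : Site d) {G D : Site d → M}
    (hGD : ∀ s ∈ slots L, ∀ x, tcls T (zpos L μ ν z s) = tcls T x → ‖G (zpos L μ ν z s)‖ = ‖D x‖) (x : Site d) :
    ‖textend T L μ ν z G D x‖ = ‖D x‖ := by
  unfold textend
  split_ifs with h
  · obtain ⟨hs, hP⟩ := Classical.choose_spec h
    exact hGD _ hs x hP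
  · rfl

/-- **FROM THE WINDOW SUM TO THE KERNEL SUM on the torus** (`T ≥ 2L`, plane `μ ≠ ν`): the weighted window sum
`Σ_{x′ ∈ B(La)} L^{−d} Σ_{p ⊂ (p′)_{x′}} G(p)` of `bch_concrete` equals the kernel sum `Σ_{x ∈ [0,T)^d} w(a, x) • Φ(p′, x)`
over ALL fine plaquettes of the plane on the torus, with the torus averaging kernel `tker` and the torus extension
`textend` — generation 11's `window_sum_eq_position_sum` (slots → positions in `ℤ^d`) followed by reduction mod `T`
(positions of one window are distinct mod `T`). [folklore] -/
theorem window_sum_eq_kernel_sum {M : Type*} [AddCommGroup M] [Module ℝ M] (hT0 : 0 < T) (h2L : 2 * L ≤ T)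
    (hμν : μ ≠ ν) (a : Site d) (G D : Site d → M) :
    ∑ r : Fin d → Fin L, ((L : ℝ) ^ d)⁻¹ • ∑ i ∈ Finset.range L, ∑ j ∈ Finset.range L,
        G (zpos L μ ν ((L : ℤ) • a) (r, i, j))
      = ∑ x ∈ box T, tker T L μ ν a x • textend T L μ ν ((L : ℤ) • a) G D x := by
  classical
  haveI : NeZero T := ⟨hT0.ne'⟩
  set z : Site d := (L : ℤ) • a with hz
  have hinj : ∀ s ∈ slots L, ∀ s' ∈ slots L, tcls T (zpos L μ ν z s) = tcls T (zpos L μ ν z s') →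
      zpos L μ ν z s = zpos L μ ν z s' := fun s hs s' hs' h => zpos_eq_of_tcls_eq L h2L hμν z hs hs' h
  have hS : Finset.univ ×ˢ (Finset.range L ×ˢ Finset.range L) = slots (d := d) L := rfl
  -- slots → positions in ℤ^d (generation 11)
  rw [window_sum_eq_position_sum L (((L : ℝ) ^ d)⁻¹) (zpos L μ ν z) G, hS]
  set P : Finset (Site d) := (slots L).image (zpos L μ ν z) with hP
  -- positions → representatives: restrict the box sum to the classes of positions
  have hQ : P.image (fun x' => tlift (tcls T x')) ⊆ box T := fun x hx => by
    obtain ⟨x', -, rfl⟩ := Finset.mem_image.1 hx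
    exact tlift_mem_box _
  have hzero : ∀ x ∈ box T, x ∉ P.image (fun x' => tlift (tcls T x')) →
      tker T L μ ν a x • textend T L μ ν z G D x = 0 := by
    intro x hx hxQ
    have : tker T L μ ν a x = 0 := by
      by_contra hne
      obtain ⟨s, hs, hsx⟩ := exists_slot_of_tker_ne_zero T L μ ν hne
      apply hxQ
      refine Finset.mem_image.2 ⟨zpos L μ ν z s, Finset.mem_image.2 ⟨s, hs, rfl⟩, ?_⟩
      rw [hsx, tlift_tcls_of_mem_box hx]
    rw [this, zero_smul]
  have hinj' : ∀ x' ∈ P, ∀ y' ∈ P, tlift (tcls T x') = tlift (tcls T y') → x' = y' := by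
    intro x' hx' y' hy' h
    obtain ⟨s, hs, rfl⟩ := Finset.mem_image.1 hx'
    obtain ⟨s', hs', rfl⟩ := Finset.mem_image.1 hy'
    exact hinj s hs s' hs' (by rw [← tcls_tlift (tcls T (zpos L μ ν z s)), h, tcls_tlift])
  rw [← Finset.sum_subset hQ hzero, Finset.sum_image hinj']
  refine Finset.sum_congr rfl fun x' hx' => ?_
  obtain ⟨s₀, hs₀, rfl⟩ := Finset.mem_image.1 hx'
  -- the weight: slots at this position, counted mod T = counted in ℤ^d
  have hw : tker T L μ ν a (tlift (tcls T (zpos L μ ν z s₀)))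
      = ((L : ℝ) ^ d)⁻¹ * (((slots L).filter fun t => zpos L μ ν z t = zpos L μ ν z s₀).card : ℝ) := by
    unfold tker
    rw [tcls_tlift]
    congr 3
    refine Finset.filter_congr fun t ht => ⟨fun h => hinj t ht s₀ hs₀ h, fun h => by rw [h]⟩
  -- the field: the chosen slot sits at the same point of ℤ^d
  have hex : ∃ s ∈ slots L, tcls T (zpos L μ ν z s) = tcls T (tlift (tcls T (zpos L μ ν z s₀))) :=
    ⟨s₀, hs₀, (tcls_tlift _).symm⟩
  have hΦ : textend T L μ ν z G D (tlift (tcls T (zpos L μ ν z s₀))) = G (zpos L μ ν z s₀) := by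
    unfold textend
    rw [dif_pos hex]
    obtain ⟨hs₁, hP₁⟩ := Classical.choose_spec hex
    rw [hinj _ hs₁ s₀ hs₀ (hP₁.trans (tcls_tlift _))]
  rw [hw, hΦ]

variable {𝔸 : Type*} [NormedRing 𝔸] [NormOneClass 𝔸] [NormedAlgebra ℂ 𝔸] [CompleteSpace 𝔸]

/-- **(bch) IN KERNEL FORM ON THE TORUS** — generation 11's `bch_concrete` RE-INDEXED: for Bałaban's concrete average
(42) on a configuration `V` on `ℤ^d` (e.g. the periodic lift of a torus configuration), `T ≥ 2L`, block index `a`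
(coarse plaquette `p′` with corner `y₀ = La` in the plane `μ ≠ ν`), under the hypotheses of Prop. 1:
`‖ψ(p′) − Σ_{x ∈ [0,T)^d} w(a, x) • Φ(p′, x)‖ ≤ 280·θ²`, `θ = 8(d+1)(d+4)L²α₀`, with `ψ(p′) = log V̄(∂p′)`, the torus
averaging kernel `w = tker` (`≥ 0`, row sums `L²`, column sums `L^{2−d}`: §5) and `Φ(p′, ·) = textend (…)` the torus
extension of the transported field `x′ ↦ T_{p′,x′} log V(∂p_{x′}) T_{p′,x′}⁻¹` — i.e. generation 10's binder
`hρA`/`hρB` `‖ψA y − Σ_{x ∈ Pf} w y x • ΦA y x‖ ≤ ρb` LITERALLY, per plane, on the torus of representatives.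
Periodicity of `V` is not needed for the inequality (only for `norm_textend_transport`).
[cite: Balaban1985Averaging, (42) p.23, (47)–(50) p.25, (51) p.26] -/
theorem bch_torus (hL : 1 ≤ L) (h2L : 2 * L ≤ T) (a : Site d) (hμν : μ ≠ ν)
    (V : Site d → Fin d → 𝔸ˣ) (hV : ∀ x κ, V x κ ∈ U1 𝔸) {α₀ : ℝ} (hα₀ : 0 ≤ α₀)
    (hsmall : 512 * (d + 1) * (d + 4) * (L : ℝ) ^ 2 * α₀ ≤ 1)
    (h44 : ∀ (x : Site d) (κ κ' : Fin d), κ ≠ κ' → ‖((hol V x (plaqWord κ κ') : 𝔸ˣ) : 𝔸) - 1‖ ≤ α₀)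
    (u : Site d → 𝔸ˣ) (hu : u = axialFn V ((L : ℤ) • a + (L : ℤ) • e μ + (L : ℤ) • e ν))
    (φ : Site d → 𝔸) (hφ : φ = fun x => MatrixLog.mlog ((hol V x (plaqWord μ ν) : 𝔸ˣ) : 𝔸))
    (G : Site d → 𝔸) (hG : G = fun x' => ((((u ((L : ℤ) • a))⁻¹ * u x' : 𝔸ˣ)) : 𝔸) * φ x'
        * ((((u ((L : ℤ) • a))⁻¹ * u x')⁻¹ : 𝔸ˣ) : 𝔸)) :
    ‖MatrixLog.mlog ((cplaq L (bavg L V) ((L : ℤ) • a) μ ν : 𝔸ˣ) : 𝔸)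
        - ∑ x ∈ box T, tker T L μ ν a x • textend T L μ ν ((L : ℤ) • a) G φ x‖
      ≤ 280 * (8 * (d + 1) * (d + 4) * (L : ℝ) ^ 2 * α₀) ^ 2 := by
  have hT0 : 0 < T := by omega
  rw [← window_sum_eq_kernel_sum T L μ ν hT0 h2L hμν a G φ]
  have hb := bch_concrete L hL ((L : ℤ) • a) hμν V hV hα₀ hsmall h44 u hu _ rfl
  subst hG hφ
  simpa only [zpos_mk] using hb

omit [CompleteSpace 𝔸] in
/-- **(tr) on the torus for a PERIODIC configuration**: the torus extension of the transported field has the norm of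
the fine Lie-algebra variable `φ(x) = log V(∂p_x)` at EVERY fine plaquette `x` — generation 10's `hΦA`/`hΦB`
(`‖ΦA y x‖ = ‖φA x‖` for all `y, x`).  Uses: transporters in `U1` (isometric conjugation, `transport_norm_eq`) and
`T`-periodicity of `V` (`V(∂p)` depends only on the class of `p`). [folklore] -/
theorem norm_textend_transport (z y : Site d) {V : Site d → Fin d → 𝔸ˣ} (hV : ∀ x κ, V x κ ∈ U1 𝔸)
    (hper : IsPeriodic T V) (u : Site d → 𝔸ˣ) (hu : u = axialFn V y)
    (φ : Site d → 𝔸) (hφ : φ = fun x => MatrixLog.mlog ((hol V x (plaqWord μ ν) : 𝔸ˣ) : 𝔸))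
    (G : Site d → 𝔸) (hG : G = fun x' => ((((u z)⁻¹ * u x' : 𝔸ˣ)) : 𝔸) * φ x' * ((((u z)⁻¹ * u x')⁻¹ : 𝔸ˣ) : 𝔸))
    (x : Site d) : ‖textend T L μ ν z G φ x‖ = ‖φ x‖ := by
  have huU : ∀ x', u x' ∈ U1 𝔸 := fun x' => hu ▸ axialFn_mem hV _ x'
  refine norm_textend T L μ ν z (fun s _ x' hsx => ?_) x
  subst hG hφ
  simp only
  rw [transport_norm_eq huU, (hper.hol (plaqWord μ ν)).eq_of_tcls_eq hsx]

/-- (osc), SUPPORT: at two fine plaquettes of non-zero weight in the same coarse plaquette, the torus extension takes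
the values of the window field at two slot positions of THAT window — so generation 10's (osc) binder
`0 < w y x → 0 < w y x′ → ‖ΦA y x − ΦA y x′‖ ≤ ω` is the oscillation of the transported field over ONE window
(`≤ 2L − 2` lattice steps across, `zpos_sub_corner_bounds`).  The RATE `ω_K` itself ((osc-U): Hölder continuity of the
minimiser) is NOT PRINTED and not proved here. [folklore] -/
theorem osc_support {M : Type*} [AddCommGroup M] {a x x' : Site d} (G D : Site d → M)
    (hx : tker T L μ ν a x ≠ 0) (hx' : tker T L μ ν a x' ≠ 0) :
    ∃ s ∈ slots L, ∃ s' ∈ slots L,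
      textend T L μ ν ((L : ℤ) • a) G D x - textend T L μ ν ((L : ℤ) • a) G D x'
        = G (zpos L μ ν ((L : ℤ) • a) s) - G (zpos L μ ν ((L : ℤ) • a) s') := by
  obtain ⟨s, hs, -, h1⟩ := textend_of_tker_ne_zero T L μ ν G D hx
  obtain ⟨s', hs', -, h2⟩ := textend_of_tker_ne_zero T L μ ν G D hx'
  exact ⟨s, hs, s', hs', by rw [h1, h2]⟩

end TorusTransport

/-! ## §7 Toy / non-vacuity -/

section Toy

/-- Toy: the hypotheses `T = nL`, `0 < T` of the slot count are satisfiable (`d = 2`, `n = L = 2`, `T = 4`): every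
point of `(ℤ/4)²` is the position of exactly `L² = 4` slots.  No physics. -/
example (ξ : Fin 2 → ZMod 4) := slot_count (d := 2) 2 (n := 2) (T := 4) rfl (by norm_num) 0 1 ξ

/-- Toy: `kernel_tower` is non-vacuous (`L = 2`, `n_K = 2^K`, all six planes of `Fin 4`).  No physics. -/
example := kernel_tower 2 (by norm_num) (fun K => 2 ^ K) (fun K => pow_pos (by norm_num) K) Finset.univ

/-- Toy: the hypotheses of `bch_torus` are JOINTLY SATISFIABLE — `V ≡ 1` on `ℤ²`, `L = 2`, `T = 4`, `α₀ = 0`,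
`𝔸 = ℂ`, plane `(0, 1)`, block `a = 0` — and then the bound is `0`: the coarse Lie-algebra variable IS the kernel sum.
No physics. -/
example :=
  bch_torus (𝔸 := ℂ) 4 2 (0 : Fin 2) 1 (by norm_num) (by norm_num) 0 (by decide) (fun _ _ => 1)
    (fun _ _ => (U1 ℂ).one_mem) le_rfl (by norm_num)
    (fun x κ κ' _ => by simp [plaqWord, stepHol_true, stepHol_false]) _ rfl _ rfl _ rfl

end Toy

end Literature.MathematicalPhysics.QuantumFieldTheory.Balaban1983to89.T4TermwiseTorus
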